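/- Copyright: ym3-torus cell, WIDTH-5 ATTACH seat `ym-ust-19936-w4` (prover, g11), for crux `HistoryTailL` (stmt-QuantumFields-19936),
line «local_insertion», height one: the LOCAL GOODNESS ROW at height one is UNCONDITIONAL.
Released under the licence of the surrounding project. -/
import Summits.QuantumFields.YangMills.Theorems.UnitScaleTiltHistoryTailBoundedHeightLocal
import Summits.QuantumFields.YangMills.Theorems.PoincareLipschitzTwoSidedOfConcentrationCounting
import Summits.QuantumFields.YangMills.Theorems.LocalInsertionInsertionHeightOneOfMeanPlaquette
import Summits.QuantumFields.YangMills.Theorems.LocalInsertionHistoryTailOfLinExpTail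
import HarnessLib

/-!
# Line «local_insertion» on crux `HistoryTailL` (stmt-QuantumFields-19936) — GOOD-1 IS UNCONDITIONAL:
# the height-one local goodness row `Gibbs_K(G(a,1)ᶜ) ≤ ¼` holds for every `L`, every profile `(b₀, p₀)` with `b₀ > 0`, `p₀ > 2`,
# once `γ ≤ γ₁(L, b₀, p₀)` — so «height one (interior `K ≥ 3`) ⟸ K1 ∧ (EQ1)», the goodness hypothesis DISCHARGED

Cell `ym3-torus` (YM ladder rung R3 = continuum SU(2) Yang–Mills on the three-torus — a RUNG, NOT the Clay problem: not d = 4, not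
infinite volume, not a mass gap), width seat `ym-ust-19936-w4` gen 11, `--supports stmt-QuantumFields-19936 --as helper`.  THEOREMS ONLY,
definition-free.

★w3 g11's ✓`LocalInsertion.InsertionHeightOneOfMeanPlaquette.insertionHeightOneInterior_of_concentration_meanPlaquette` reduces the
registered stub `stub_insertionHeightOne` of `Cruxes/HistoryTailL/Lines/local_insertion.lean` (interior cut-offs `K ≥ 3`) to THREE displayed
rows: K1 = `Theses.PoincareLipschitz.MesoscopicConcentrationL` (stmt-23532), (EQ1) «`∫ dist1 U(∂p) ∂Gibbs_K ≤ C₁·√(γL^{−K})`», and the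
height-one LOCAL GOODNESS row `hGood` «`Gibbs_K{∃ q ∈ Plaq(T^{(0)}), corner of q within 64L − 64 of the corner of a, θ(K) ≤ |U(∂q) − 1|} ≤ ¼`
for `γ ≤ γ₁(L, b₀, p₀)`».  THIS FILE PROVES `hGood` OUTRIGHT (§2 ★★`good_heightOne`, the hypothesis text VERBATIM) and records the reduced knit
(§3 ★★★`insertionHeightOneInterior_of_concentration_meanPlaquette'`: height one ⟸ K1 ∧ (EQ1)).

WHY NO (T4) ∕ (GT)-UNIFORM INPUT IS NEEDED (located, numbers): at `j = 1` only fine plaquettes (`i = 0`) enter the good set, and the tree's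
VOLUME-UNIFORM bounded-height certificate ✓`HistoryTailBoundedHeightLocal.perPlaquette_boundedHeight_uniform (L) (j₀ := 0)` already gives
`Gibbs_K{θ(K) ≤ |U(∂q) − 1|} ≤ C(L)·β_K^5·exp(−c(L)·p(g_K)²)` with constants fixed BEFORE the family, the coupling and the volume
(reflection positivity + small Haar balls, [FrohlichIsraelLiebSimon1978] Thm 4.1).  The threshold `θ(K) = g_K·p(g_K)` is `√log`-LARGE
against the Gaussian scale `g_K = β_K^{−1/2}`: `p(g_K) = b₀(1 + ½log β_K)^{p₀} ≥ b₀·½log β_K`, so `β_K^5·exp(−c·p(g_K)²) ≤ exp(10y − cb₀²y²)`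
(`y = ½log β_K`; ✓`LocalInsertionLinExpDoor.mul_log_inv_le_pFun`) is eventually smaller than any constant (§1 `poly_gauss_absorb`) — the polynomial prefactor that forces the prefactor-free
(EM)∕(T4) machinery on (EQ1) (a statement AT the Gaussian scale) is harmless here.  The near plaquettes number at most `9·129³·L³`
(cross-cell ✓`PoincareLipschitz.TwoSidedOfConcentration.card_near_le_real`, volume- and `K`-free), and `β_K = L^K∕γ ≥ γ⁻¹`, so
`γ₁ := exp(−2y⋆)` with `y⋆ = max(20∕(cb₀²), log(4(NC + 1))∕10)` does it for EVERY `K` (the row's `j + 2 ≤ K` is not even used).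

HONEST FRAMING.  Elementary (union bound + chessboard + arithmetic).  CONDITIONAL rows that REMAIN in §3: K1 (23532, organ-class) and (EQ1)
(supplied γ-uniformly modulo the d = 3 one-site doubling T4-ONE by ★w4 g10's `LocalInsertionExpMomentSU2TorusUniformT3`; unconditional once
★w7 g10's (T4-SUB) chain lands).  Nothing of `LocalInsertionL` (23607), the registered stubs, the crux `HistoryTailL`, K1, d = 4, a continuum
limit or a mass gap is proved.  YM₃ on T³ is rung R3, NOT the Clay problem.

References: T. Bałaban, CMP **102** (1985) 255–275 [Balaban1985UV3] ((7) p.257: `p(g) = b₀(1 + log g⁻¹)^{p₀}`, `p₀ > 2`; (71) p.273);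
J. Fröhlich, R. Israel, E. Lieb, B. Simon, CMP 62 (1978) [FrohlichIsraelLiebSimon1978] (Thm 4.1, chessboard estimate).
-/

set_option autoImplicit false

noncomputable section

open scoped BigOperators
open MeasureTheory
open Literature.MathematicalPhysics.QuantumFieldTheory.Balaban1983to89
open Literature.MathematicalPhysics.QuantumFieldTheory.Balaban1983to89.T3ContinuumYM3Torus
open Literature.MathematicalPhysics.QuantumFieldTheory.Balaban1983to89.T3UnitScaleTilt
open Literature.MathematicalPhysics.QuantumFieldTheory.Balaban1983to89.T3UnitLawDensityEML
open Literature.MathematicalPhysics.QuantumFieldTheory.Balaban1983to89.T3UpperLiftSplit (scheme_β_eq)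
open Summit.QuantumFields.YangMills.Theorems.HistoryTailBoundedHeightLocal (perPlaquette_boundedHeight_uniform)
open Summit.QuantumFields.YangMills.Theorems.PoincareLipschitz.TwoSidedOfConcentration (card_near_le_real compl_localGood_subset)
open Summit.QuantumFields.YangMills.Theorems.LocalInsertion.InsertionHeightOneOfMeanPlaquette
  (insertionHeightOneInterior_of_concentration_meanPlaquette)
open Summit.QuantumFields.YangMills.Theorems.LocalInsertionLinExpDoor (mul_log_inv_le_pFun)

namespace Summit.QuantumFields.YangMills.Theorems.LocalInsertion.GoodHeightOne

/-! ## §1 Arithmetic: a polynomial prefactor is absorbed by the Gaussian-in-`p(g)` factor -/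

/-- `10y − Ay² ≤ −M` once `y ≥ max(20∕A, M∕10)` (`A > 0`). [folklore] -/
theorem ten_mul_sub_sq_le {A M y : ℝ} (hA : 0 < A) (hy : max (20 / A) (M / 10) ≤ y) : 10 * y - A * y ^ 2 ≤ -M := by
  have h20 : 20 / A ≤ y := (le_max_left _ _).trans hy
  have hM : M / 10 ≤ y := (le_max_right _ _).trans hy
  have hy0 : 0 ≤ y := (div_pos (by norm_num) hA).le.trans h20
  have hAy : 20 ≤ A * y := by
    have h := mul_le_mul_of_nonneg_left h20 hA.le
    rwa [mul_div_cancel₀ _ hA.ne'] at h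
  have hAy2 : 20 * y ≤ A * y ^ 2 := by nlinarith
  linarith

/-- **POLYNOMIAL × GAUSSIAN-IN-`p(g)` IS EVENTUALLY SMALL.**  For `N, C ≥ 0`, `c > 0`, `b₀ > 0`, `p₀ ≥ 1` there is `x⋆ ∈ (0, 1]` with
`N·(C·x⁻⁵·exp(−c·p(√x)²)) ≤ ¼` for all `0 < x ≤ x⋆` (`x = g² = β⁻¹`; `x⁻⁵ = e^{10y}`, `p(√x) ≥ b₀y`, `y = log(√x)⁻¹`; `x⋆ = e^{−2y⋆}`,
`y⋆ = max(20∕(cb₀²), log(4(NC+1))∕10)`). [folklore] -/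
theorem poly_gauss_absorb {N C c b₀ p₀ : ℝ} (hN : 0 ≤ N) (hC : 0 ≤ C) (hc : 0 < c) (hb₀ : 0 < b₀) (hp₀ : 1 ≤ p₀) :
    ∃ xs : ℝ, 0 < xs ∧ xs ≤ 1 ∧ ∀ x : ℝ, 0 < x → x ≤ xs →
      N * (C * (x⁻¹) ^ 5 * Real.exp (-(c * B10.pFun b₀ p₀ (Real.sqrt x) ^ 2))) ≤ 1 / 4 := by
  set A : ℝ := c * b₀ ^ 2 with hA
  have hA0 : 0 < A := by positivity
  set M : ℝ := Real.log (4 * (N * C + 1)) with hM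
  set ys : ℝ := max (20 / A) (M / 10) with hys
  have hys0 : 0 < ys := lt_max_of_lt_left (div_pos (by norm_num) hA0)
  refine ⟨Real.exp (-(2 * ys)), Real.exp_pos _, by rw [Real.exp_le_one_iff]; linarith, fun x hx hxs => ?_⟩
  -- `y = log (√x)⁻¹ = -(log x)/2 ≥ ys`
  set y : ℝ := Real.log (Real.sqrt x)⁻¹ with hy
  have hx1 : x ≤ 1 := hxs.trans (by rw [Real.exp_le_one_iff]; linarith)
  have hyeq : y = -(Real.log x) / 2 := by rw [hy, Real.log_inv, Real.log_sqrt hx.le]; ring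
  have hyge : ys ≤ y := by
    have h := Real.log_le_log hx hxs
    rw [Real.log_exp] at h
    rw [hyeq]; linarith
  have hy0 : 0 ≤ y := hys0.le.trans hyge
  -- `x⁻¹ ^ 5 = exp (10 y)`
  have hinv : x⁻¹ = Real.exp (2 * y) := by
    rw [hyeq, show 2 * (-Real.log x / 2) = -Real.log x by ring, Real.exp_neg, Real.exp_log hx]
  have hpow : (x⁻¹) ^ 5 = Real.exp (10 * y) := by
    rw [hinv, ← Real.exp_nat_mul]; ring_nf
  -- `c p² ≥ A y²`
  have hsx : 0 < Real.sqrt x := Real.sqrt_pos.mpr hx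
  have hsx1 : Real.sqrt x ≤ 1 := Real.sqrt_le_one.mpr hx1
  have hp : b₀ * y ≤ B10.pFun b₀ p₀ (Real.sqrt x) := mul_log_inv_le_pFun hb₀.le hp₀ hsx hsx1
  have hby0 : 0 ≤ b₀ * y := mul_nonneg hb₀.le hy0
  have hp2 : A * y ^ 2 ≤ c * B10.pFun b₀ p₀ (Real.sqrt x) ^ 2 := by
    have h2 : (b₀ * y) ^ 2 ≤ B10.pFun b₀ p₀ (Real.sqrt x) ^ 2 := pow_le_pow_left₀ hby0 hp 2
    calc A * y ^ 2 = c * (b₀ * y) ^ 2 := by rw [hA]; ring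
      _ ≤ c * B10.pFun b₀ p₀ (Real.sqrt x) ^ 2 := mul_le_mul_of_nonneg_left h2 hc.le
  -- the exponent
  have hexp : (x⁻¹) ^ 5 * Real.exp (-(c * B10.pFun b₀ p₀ (Real.sqrt x) ^ 2)) ≤ Real.exp (-M) := by
    rw [hpow, ← Real.exp_add]
    rw [Real.exp_le_exp]
    have h := ten_mul_sub_sq_le (M := M) hA0 hyge
    linarith
  have hNC : 0 < N * C + 1 := by positivity
  have hexpM : Real.exp (-M) = (4 * (N * C + 1))⁻¹ := by
    rw [hM, Real.exp_neg, Real.exp_log (by positivity)]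
  calc N * (C * (x⁻¹) ^ 5 * Real.exp (-(c * B10.pFun b₀ p₀ (Real.sqrt x) ^ 2)))
      = N * C * ((x⁻¹) ^ 5 * Real.exp (-(c * B10.pFun b₀ p₀ (Real.sqrt x) ^ 2))) := by ring
    _ ≤ N * C * Real.exp (-M) := mul_le_mul_of_nonneg_left hexp (mul_nonneg hN hC)
    _ = N * C / (4 * (N * C + 1)) := by rw [hexpM, div_eq_mul_inv]
    _ ≤ 1 / 4 := by
        rw [div_le_div_iff₀ (by positivity) (by norm_num)]
        nlinarith [mul_nonneg hN hC]

/-! ## §2 GOOD-1: the height-one local goodness row, unconditionally -/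

/-- **GOOD-1 — THE HEIGHT-ONE LOCAL GOODNESS ROW IS UNCONDITIONAL.**  For every `L`, every profile `b₀ > 0`, `p₀ > 2` there is
`γ₁ ∈ (0, 1]` such that for every family `F` with `F.L = L`, every `0 < γ ≤ γ₁`, every cut-off `K` (the row's `j = 1`, `j + 2 ≤ K`), and
every plaquette `a` of `T^{(1)}`: the Gibbs mass of the configurations with SOME fine plaquette `q` near `a` (finest corners within
`64L − 64`) carrying `θ(K) ≤ |U(∂q) − 1|` is at most `¼`.  This is the hypothesis `hGood` of
✓`InsertionHeightOneOfMeanPlaquette.insertionHeightOneInterior_of_concentration_meanPlaquette` VERBATIM.  Union bound over the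
`≤ 9·129³·L³` near plaquettes (✓`card_near_le_real`) of the volume-uniform finest-height chessboard tail
(✓`perPlaquette_boundedHeight_uniform (j₀ := 0)`: `C·β_K^5·e^{−c·p(g_K)²}`), and §1 (`β_K = L^K∕γ ≥ γ₁⁻¹`).  Elementary; nothing of K1,
(EQ1), the stubs or the crux is proved. [cite: Balaban1985UV3, (7) p.257 and (71) p.273; FrohlichIsraelLiebSimon1978, Thm 4.1] -/
theorem good_heightOne :
    ∀ (L : ℕ) (b₀ p₀ : ℝ), 0 < b₀ → 2 < p₀ → ∃ γ₁ : ℝ, 0 < γ₁ ∧ γ₁ ≤ 1 ∧ ∀ (F : T3Family) (γ : ℝ), F.L = L → 0 < γ → γ ≤ γ₁ →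
      ∀ (K j : ℕ), 1 ≤ j → j + 2 ≤ K → j ≤ 1 → ∀ (a : Plaq (F.P K) j),
        (gibbsK F ℰp γ K).real {U : GaugeField (F.P K) 0 (Matrix.specialUnitaryGroup (Fin 2) ℂ) |
          (∀ (i : ℕ) (q : Plaq (F.P K) i), i < j →
            Site.tdist (fun k => ((((q.src k).val * F.L ^ i : ℕ)) : ZMod ((F.P K).sitesPerDir 0)))
                (fun k => ((((a.src k).val * F.L ^ j : ℕ)) : ZMod ((F.P K).sitesPerDir 0))) + 64 * F.L ^ i ≤ 64 * F.L ^ j →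
            GaugeGroup.dist1 (GaugeField.plaqHol
              (Averaging.iter (fun i' => BlockAveraging.blockAvg (P := F.P K) (j := i') ℰp) i U) q) <
              θBal F.L γ b₀ p₀ (K - i))}ᶜ ≤ 1 / 4 := by
  intro L b₀ p₀ hb₀ hp₀
  obtain ⟨C, c, hC, hc, hper⟩ := perPlaquette_boundedHeight_uniform L 0
  obtain ⟨xs, hxs0, hxs1, habs⟩ :=
    poly_gauss_absorb (N := 9 * 129 ^ 3 * (L : ℝ) ^ 3) (p₀ := p₀) (by positivity) hC hc hb₀ (by linarith)
  refine ⟨xs, hxs0, hxs1, fun F γ hFL hγ hγle K j hj _ hj1 a => ?_⟩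
  obtain rfl : j = 1 := le_antisymm hj1 hj
  haveI := isProbabilityMeasure_gibbsK F ℰp hγ.le K
  have hγ1 : γ ≤ 1 := hγle.trans hxs1
  -- names
  set μ := gibbsK F ℰp γ K with hμ
  set near : (i : ℕ) → Finset (Plaq (F.P K) i) := fun i => Finset.univ.filter fun q : Plaq (F.P K) i =>
      Site.tdist (fun k => ((((q.src k).val * F.L ^ i : ℕ)) : ZMod ((F.P K).sitesPerDir 0)))
          (fun k => ((((a.src k).val * F.L ^ 1 : ℕ)) : ZMod ((F.P K).sitesPerDir 0))) + 64 * F.L ^ i ≤ 64 * F.L ^ 1 with hnear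
  -- (i) the finest-bad-level covering, at `j = 1`: only `i = 0` enters
  have hcov := compl_localGood_subset F K 1 a
    (fun i q U => GaugeGroup.dist1 (GaugeField.plaqHol
      (Averaging.iter (fun i' => BlockAveraging.blockAvg (P := F.P K) (j := i') ℰp) i U) q))
    (fun i => θBal F.L γ b₀ p₀ (K - i))
  have hstep1 : μ.real {U : GaugeField (F.P K) 0 (Matrix.specialUnitaryGroup (Fin 2) ℂ) |
          (∀ (i : ℕ) (q : Plaq (F.P K) i), i < 1 →
            Site.tdist (fun k => ((((q.src k).val * F.L ^ i : ℕ)) : ZMod ((F.P K).sitesPerDir 0)))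
                (fun k => ((((a.src k).val * F.L ^ 1 : ℕ)) : ZMod ((F.P K).sitesPerDir 0))) + 64 * F.L ^ i ≤ 64 * F.L ^ 1 →
            GaugeGroup.dist1 (GaugeField.plaqHol
              (Averaging.iter (fun i' => BlockAveraging.blockAvg (P := F.P K) (j := i') ℰp) i U) q) <
              θBal F.L γ b₀ p₀ (K - i))}ᶜ ≤
      ∑ i ∈ Finset.range 1, ∑ q ∈ near i,
        μ.real ({U : GaugeField (F.P K) 0 (Matrix.specialUnitaryGroup (Fin 2) ℂ) | θBal F.L γ b₀ p₀ (K - i) ≤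
            GaugeGroup.dist1 (GaugeField.plaqHol
              (Averaging.iter (fun i' => BlockAveraging.blockAvg (P := F.P K) (j := i') ℰp) i U) q)} ∩
          {U : GaugeField (F.P K) 0 (Matrix.specialUnitaryGroup (Fin 2) ℂ) | ∀ (i' : ℕ) (q' : Plaq (F.P K) i'), i' < i →
            Site.tdist (fun k => ((((q'.src k).val * F.L ^ i' : ℕ)) : ZMod ((F.P K).sitesPerDir 0)))
                (fun k => ((((q.src k).val * F.L ^ i : ℕ)) : ZMod ((F.P K).sitesPerDir 0))) + 64 * F.L ^ i' ≤ 64 * F.L ^ i →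
            GaugeGroup.dist1 (GaugeField.plaqHol
              (Averaging.iter (fun i'' => BlockAveraging.blockAvg (P := F.P K) (j := i'') ℰp) i' U) q') <
              θBal F.L γ b₀ p₀ (K - i')}) := by
    refine (measureReal_mono hcov (measure_ne_top _ _)).trans ?_
    refine (measureReal_biUnion_finset_le _ _).trans ?_
    exact Finset.sum_le_sum fun i _ => measureReal_biUnion_finset_le _ _
  refine hstep1.trans ?_
  rw [Finset.sum_range_one]
  -- (ii) each fine term: drop the history part, then the volume-uniform chessboard tail
  set x : ℝ := γ * ((F.L : ℝ)⁻¹) ^ K with hx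
  have hL1 : (1 : ℝ) ≤ F.L := by exact_mod_cast F.hL.2.le
  have hx0 : 0 < x := by positivity
  have hxγ : x ≤ γ := by
    have h1 : ((F.L : ℝ)⁻¹) ^ K ≤ 1 := pow_le_one₀ (by positivity) (inv_le_one_of_one_le₀ hL1)
    calc x = γ * ((F.L : ℝ)⁻¹) ^ K := rfl
      _ ≤ γ * 1 := mul_le_mul_of_nonneg_left h1 hγ.le
      _ = γ := mul_one _
  have hterm : ∀ q : Plaq (F.P K) 0,
      μ.real ({U : GaugeField (F.P K) 0 (Matrix.specialUnitaryGroup (Fin 2) ℂ) | θBal F.L γ b₀ p₀ (K - 0) ≤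
            GaugeGroup.dist1 (GaugeField.plaqHol
              (Averaging.iter (fun i' => BlockAveraging.blockAvg (P := F.P K) (j := i') ℰp) 0 U) q)} ∩
          {U : GaugeField (F.P K) 0 (Matrix.specialUnitaryGroup (Fin 2) ℂ) | ∀ (i' : ℕ) (q' : Plaq (F.P K) i'), i' < 0 →
            Site.tdist (fun k => ((((q'.src k).val * F.L ^ i' : ℕ)) : ZMod ((F.P K).sitesPerDir 0)))
                (fun k => ((((q.src k).val * F.L ^ 0 : ℕ)) : ZMod ((F.P K).sitesPerDir 0))) + 64 * F.L ^ i' ≤ 64 * F.L ^ 0 →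
            GaugeGroup.dist1 (GaugeField.plaqHol
              (Averaging.iter (fun i'' => BlockAveraging.blockAvg (P := F.P K) (j := i'') ℰp) i' U) q') <
              θBal F.L γ b₀ p₀ (K - i')}) ≤
        C * (x⁻¹) ^ 5 * Real.exp (-(c * B10.pFun b₀ p₀ (Real.sqrt x) ^ 2)) := by
    intro q
    refine (measureReal_mono Set.inter_subset_left (measure_ne_top _ _)).trans ?_
    have h := hper F hFL γ hγ hγ1 b₀ hb₀.le p₀ K 0 (Nat.zero_le K) le_rfl q
    rw [scheme_β_eq, Nat.sub_zero] at h
    exact h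
  have hsum : ∑ q ∈ near 0,
        μ.real ({U : GaugeField (F.P K) 0 (Matrix.specialUnitaryGroup (Fin 2) ℂ) | θBal F.L γ b₀ p₀ (K - 0) ≤
            GaugeGroup.dist1 (GaugeField.plaqHol
              (Averaging.iter (fun i' => BlockAveraging.blockAvg (P := F.P K) (j := i') ℰp) 0 U) q)} ∩
          {U : GaugeField (F.P K) 0 (Matrix.specialUnitaryGroup (Fin 2) ℂ) | ∀ (i' : ℕ) (q' : Plaq (F.P K) i'), i' < 0 →
            Site.tdist (fun k => ((((q'.src k).val * F.L ^ i' : ℕ)) : ZMod ((F.P K).sitesPerDir 0)))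
                (fun k => ((((q.src k).val * F.L ^ 0 : ℕ)) : ZMod ((F.P K).sitesPerDir 0))) + 64 * F.L ^ i' ≤ 64 * F.L ^ 0 →
            GaugeGroup.dist1 (GaugeField.plaqHol
              (Averaging.iter (fun i'' => BlockAveraging.blockAvg (P := F.P K) (j := i'') ℰp) i' U) q') <
              θBal F.L γ b₀ p₀ (K - i')}) ≤
      (near 0).card * (C * (x⁻¹) ^ 5 * Real.exp (-(c * B10.pFun b₀ p₀ (Real.sqrt x) ^ 2))) := by
    have h := Finset.sum_le_sum fun q (_ : q ∈ near 0) => hterm q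
    rwa [Finset.sum_const, nsmul_eq_mul] at h
  refine hsum.trans ?_
  -- (iii) the local count and the absorption
  have hcard : ((near 0).card : ℝ) ≤ 9 * 129 ^ 3 * (L : ℝ) ^ 3 := by
    have h := card_near_le_real F (i := 0) (j := 1) zero_le_one (by omega) a
    have hL3 : ((F.L : ℝ) ^ (1 - 0)) ^ 3 = (L : ℝ) ^ 3 := by rw [Nat.sub_zero, pow_one, hFL]
    rw [hL3] at h
    exact h
  have hRHS0 : 0 ≤ C * (x⁻¹) ^ 5 * Real.exp (-(c * B10.pFun b₀ p₀ (Real.sqrt x) ^ 2)) := by positivity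
  calc ((near 0).card : ℝ) * (C * (x⁻¹) ^ 5 * Real.exp (-(c * B10.pFun b₀ p₀ (Real.sqrt x) ^ 2)))
      ≤ 9 * 129 ^ 3 * (L : ℝ) ^ 3 * (C * (x⁻¹) ^ 5 * Real.exp (-(c * B10.pFun b₀ p₀ (Real.sqrt x) ^ 2))) :=
        mul_le_mul_of_nonneg_right hcard hRHS0
    _ ≤ 1 / 4 := habs x hx0 (hxγ.trans hγle)

/-! ## §3 Height one ⟸ K1 ∧ (EQ1): the goodness row discharged -/

/-- **HEIGHT ONE FROM K1 ∧ (EQ1), BY NAME — the local goodness row DISCHARGED by §2.**  ★w3 g11's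
✓`insertionHeightOneInterior_of_concentration_meanPlaquette` with its third hypothesis supplied by ★★`good_heightOne`: for every `L`, every
`ε ≥ 0`, every profile `b₀ > 0`, `p₀ > 2`, a `K`-, plaquette-uniform `M₀` and `γ₁` with
`∫_{G(a,1)} exp(ε·min(dist1(Ū¹(∂a))∕g_{K−1}, p(g_{K−1}))) ∂Gibbs_K ≤ M₀` at `j = 1`, `j + 2 ≤ K`.  CONDITIONAL on K1 (stmt-23532) and (EQ1) only;
nothing of the stubs ∕ cruxes is proved. [cite: Balaban1985UV3, (7) p.257 and (71) p.273] -/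
theorem insertionHeightOneInterior_of_concentration_meanPlaquette'
    (hK1 : Summit.QuantumFields.YangMills.Theses.PoincareLipschitz.MesoscopicConcentrationL)
    (hEQ1 : ∀ (L : ℕ), ∃ C₁ : ℝ, 0 ≤ C₁ ∧ ∃ γ₁ : ℝ, 0 < γ₁ ∧ γ₁ ≤ 1 ∧ ∀ (F : T3Family) (γ : ℝ), F.L = L → 0 < γ → γ ≤ γ₁ → ∀ (K : ℕ) (p : Plaq (F.P K) 0), ∫ U, GaugeGroup.dist1 (GaugeField.plaqHol U p) ∂(gibbsK F ℰp γ K) ≤ C₁ * Real.sqrt (γ * ((F.L : ℝ)⁻¹) ^ K)) :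
    ∀ (L : ℕ) (ε : ℝ), 0 ≤ ε → ∀ (b₀ p₀ : ℝ), 0 < b₀ → 2 < p₀ → ∃ M₀ : ℝ, 0 ≤ M₀ ∧ ∃ γ₁ : ℝ, 0 < γ₁ ∧ γ₁ ≤ 1 ∧ ∀ (F : T3Family) (γ : ℝ), F.L = L → 0 < γ → γ ≤ γ₁ → ∀ (K j : ℕ), 1 ≤ j → j + 2 ≤ K → j ≤ 1 → ∀ (a : Plaq (F.P K) j), ∫ U in {U : GaugeField (F.P K) 0 (Matrix.specialUnitaryGroup (Fin 2) ℂ) | (∀ (i : ℕ) (q : Plaq (F.P K) i), i < j → Site.tdist (fun k => ((((q.src k).val * F.L ^ i : ℕ)) : ZMod ((F.P K).sitesPerDir 0))) (fun k => ((((a.src k).val * F.L ^ j : ℕ)) : ZMod ((F.P K).sitesPerDir 0))) + 64 * F.L ^ i ≤ 64 * F.L ^ j → GaugeGroup.dist1 (GaugeField.plaqHol (Averaging.iter (fun i' => BlockAveraging.blockAvg (P := F.P K) (j := i') ℰp) i U) q) < θBal F.L γ b₀ p₀ (K - i))}, Real.exp (ε * min (GaugeGroup.dist1 (GaugeField.plaqHol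 (Averaging.iter (fun i' => BlockAveraging.blockAvg (P := F.P K) (j := i') ℰp) j U) a) / Real.sqrt (γ * ((F.L : ℝ)⁻¹) ^ (K - j))) (B10.pFun b₀ p₀ (Real.sqrt (γ * ((F.L : ℝ)⁻¹) ^ (K - j))))) ∂(gibbsK F ℰp γ K) ≤ M₀ :=
  insertionHeightOneInterior_of_concentration_meanPlaquette hK1 hEQ1 good_heightOne

end Summit.QuantumFields.YangMills.Theorems.LocalInsertion.GoodHeightOne

end
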